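import Literature.MathematicalPhysics.QuantumFieldTheory.Balaban1983to89.T4BoundaryRate

/-!
# BoundaryRateOpDisc — the two-run proper part `OpDisc` of the boundary-member frame ONE LEVEL DOWN: operator reading ×
one-run operator modulus × operator η-rate (cell `pub-balaban`, T⁴ fan-out, `HOME/BINDER-OWNERS.md` row NE5, route P3
«boundary-functional member»; ROUND-2 skeleton `t4/skeletons/NE5-t4-ne5-p3.md` leaf L11; lineage t4-ne5-p3 gen 17; typing +
bookkeeping only; imports the Literature leaf `T4BoundaryRate` (v1.6.2) ONLY and modifies nothing of it)

HONEST FRAMING (T4-DAG PAGE 1; identical to the parent's).  The cell's T⁴ target is rung (B)+1: existence AND uniqueness of the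
ε → 0 limit of Bałaban's unit-scale averaged loop expectations on a FIXED finite torus — strictly beyond ultraviolet stability,
NOT infinite volume, NOT a mass gap, NOT the Clay problem.  HONEST DEPENDENCY (cell line, verbatim): «continuum YM on T⁴ ⇐
BetaPertH ∧ nine spine estimates (0/9 proved); BetaPertH ⇐ (D1) ∧ (D4) ∧ CAP+tail; G-an2-4 gates asym, D1 and NE2/3/4.»  This
module asserts NOTHING about Bałaban's objects: every `def … : Prop` is a HYPOTHESIS SHAPE with parameters over the ABSTRACT
carriers of `T4BoundaryCarrier`/`T4BoundaryRate`, every theorem is [folklore] real-inequality bookkeeping.  The boundary member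
`T4BoundaryCarrier.NE5B` of the cell's spine estimate NE5 is NOT PRINTED and is NOT proved here.

WHAT THIS MODULE DOES.  In the parent's split `T4BoundaryRate.genLip_of_split` the only binder comparing the TWO runs' generation
steps on the SAME inputs is `OpDisc ΦA Φ BA EA W κ θ Cop`: run A's generation map at the transported background versus run B's map
fed with run A's transported tables differ by `≤ Cop·θ^{scale X}·e^{−κd(X)}`.  For a piece WITH NO PARENTS this inequality IS the
target inequality of `NE5B` at that piece (the base of the parent's induction over the creation step), so a skeleton that lists
`OpDisc` as a leaf must show what it is made of.  This module types the three constituents and derives `OpDisc` from them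
(`opDisc_of_split`, `Cop = Λ·δ`):
* `ReadsOpA` / `ReadsOpB` — READING (identifications, no inequality): both runs' generation maps are ONE map `Ψ` of an OPERATOR
  DATUM `q : Op` (everything a generation step uses that is not an input piece: the fluctuation covariance `C^{(k)}(Λ_{k+1})`, the
  propagators and the minimizing function `𝐇_k`, the averaging operators, the internal backgrounds `U_k(…)`, `U_{k+1}` of the
  interpolating measures ⟨·⟩_{s,t} of [Balaban1988Convergent] (3.27) p. 271; for the R-step's new boundary terms 𝐁′^{(k)} of
  [Balaban1989LargeFieldII] (1.98)–(1.101) p. 390 the 𝐓-operations and their measures), run A reading `Ψ (opA g X)` at its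
  transported tables, run B reading `Ψ (opB g X)`;
* `OpLip` — ONE RUN, NO η: `Ψ` is LIPSCHITZ IN THE OPERATOR DATUM within a margin `r X`, at admissible input tables, with modulus
  `Λ` and the decay factor — the regularity that print STATES as a type for the small-field expansions, [Balaban1988RG2Cluster]
  p. 3: *"we can replace the propagators by arbitrary operators having the same regularity properties and satisfying the same
  bounds"* (the cluster-expansion terms are *"functionals of these operators"*), and that the E-member's route P1 carries as its
  wall W2-op (`T4InputCauchyRateData.StepModel.DataLipschitz` / `OpFibreEnvelope`, row NE5 owner); for the boundary generation step
  NO such modulus is printed ([Balaban1988Convergent] p. 276: *"The expression determined by the boundary terms 𝐁_k is much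
  simpler […] To its terms we apply the formulas (3.6), (3.7) [I], and next we localize the obtained expressions."*);
* `OpRate` — THE η-RATE OF THE OPERATOR DATUM: `dist X (opA g X) (opB g X) ≤ δ·θ^{scale X}·r X` — the objects of rows NE2 (node U1a:
  covariances / propagators / averaging at two spacings, `T4EtaRate`, `CovariantAveragingTower.OneStepAveragedLaw`,
  `BackgroundResolventTower.PerturbationLaws`) and NE3 (node U1b: `T4OutputRate.BackgroundsClose` for the internal backgrounds,
  read through the background modulus `T4BoundaryCarrier.LipBackgroundFl`, itself DERIVED from analyticity + margin by
  `T4BoundaryCarrier.lipBackgroundFl_of_analyticMargin`), in the SAME currency `δ·θ^k·(margin)` as route P1's wall W1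
  `StepModel.OperatorRate` — so one producer feeds both members.  NOT PRINTED (the manuscripts construct ONE run).
`ne5B_of_opSplit` re-assembles the parent's END face `ne5B_of_split` with `OpDisc` replaced by the three constituents (conclusion
`NE5B` LITERALLY), and §3 realises the split NON-DEGENERATELY on the parent's chain instance (`chain_opDisc_of_split` recovers
`T4BoundaryRate.chain_opDisc`'s `Cop = 1` as `Λ·δ = 1·1`).  THE UNPAIRED OLDEST SCALE of run B (one more step than run A) is NOT
a fourth constituent: indexing run B's first-step pieces at a creation step where run A's functional is `0` makes `NE5B` there the
printed one-run bound (2.42) p. 261 (quoted leaf), and those pieces are ordinary parents afterwards — a convention of the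
instantiation (node U5a's synchronisation), recorded in the skeleton, not typed here.

DISGUISE TEST (for the referee).  `ReadsOpA/B` carry no inequality; `OpLip` quantifies over two ARBITRARY data `q, q'` of ONE
run's map (no transport, no second spacing, no θ); `OpRate` is an inequality between INPUT OPERATORS of the two runs (node U1a/U1b
objects), not between outputs.  None of the three implies `OpDisc` alone (§3: on the chain each holds with the others' constants
set to 0 only when the source vanishes).

Names used — parent `T4BoundaryRate`: `GenMap`, `BTable`, `ETable`, `tabA`, `etabA`, `pullB`, `epullB`, `tabB`, `etabB`,
`RepresentsA`, `RepresentsB`, `InputLipB`, `OpDisc`, `PerParentDamped`, `SliceCountGrowing`, `EKernelContracts`, `ne5B_of_split`,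
`chainCarriers`, `chainGeneration`, `chainGenA`, `chainGenB`, `chainBA`, `chainEA`; `T4BoundaryCarrier.NE5B`, `BFunctional`;
`T4OutputRate.Functional`, `NE5`; Mathlib: `div_le_iff₀`, `mul_le_mul_of_nonneg_left`, `Real.exp_pos`.  Cell record: skeleton
`t4/skeletons/NE5-t4-ne5-p3.md` §3 L11 / §4 O5; lineage record `t4/T4-EST-U3-NE5B-P3.md` (frozen v1.19) §0(d), §5.
-/

namespace Summit.QuantumFields.BalabanUV.T4Continuum.BoundaryRateOpDisc

open Finset
open Literature.MathematicalPhysics.QuantumFieldTheory.Balaban1983to89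
open T4OutputRate T4BoundaryCarrier T4BoundaryRate

variable {C : T4BoundaryCarrier.Carriers} {Op : Type}

/-! ## §1 The three constituents of `OpDisc` (binders only — nothing asserted) -/

/-- **READING, run A** (identification; NOT a printed object): run A's generation map at run A's own tables and the TRANSPORTED
background is the common map `Ψ` at run A's operator datum `opA g X`, fed with run A's tables pulled back along the transport
((3.25) p. 270 / (3.27) p. 271 read as "the piece indexed by X is a function of the older pieces' tables and of the step's own
operators"; CONTEXT only, asserted for nothing of Bałaban's). [bookkeeping] [cite: Balaban1988Convergent, (3.27) p.271] -/
def ReadsOpA (Ψ : Op → GenMap C C.BgB) (opA : (ℕ → ℝ) → C.Dom → Op) (ΦA : GenMap C C.BgA)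
    (BA : BFunctional C C.BgA) (EA : Functional C.toCarriers C.BgA) (W : Set (ℕ → ℝ)) : Prop :=
  ∀ g ∈ W, ∀ (X : C.Dom) (U : C.BgB), ∀ a ∈ C.admFl,
    ΦA g (tabA BA g) (etabA EA g) X (C.transport U) a = Ψ (opA g X) g (pullB BA g) (epullB EA g) X U a

/-- **READING, run B** (identification): run B's generation map is the common map `Ψ` at run B's operator datum `opB g X`, on the
admissible input tables (CONTEXT as for `ReadsOpA`; asserted for nothing of Bałaban's). [bookkeeping]
[cite: Balaban1988Convergent, (3.27) p.271] -/
def ReadsOpB (Ψ : Op → GenMap C C.BgB) (opB : (ℕ → ℝ) → C.Dom → Op) (Φ : GenMap C C.BgB) (W : Set (ℕ → ℝ))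
    (Adm : (ℕ → ℝ) → BTable C C.BgB → ETable C C.BgB → Prop) : Prop :=
  ∀ g ∈ W, ∀ (f : BTable C C.BgB) (e : ETable C C.BgB), Adm g f e →
    ∀ (X : C.Dom) (U : C.BgB), ∀ a ∈ C.admFl, Φ g f e X U a = Ψ (opB g X) g f e X U a

/-- **HYPOTHESIS SHAPE `OpLip`** (ONE run, NO η; NOT PRINTED as a modulus for the boundary generation step): at admissible input
tables the common generation map is LIPSCHITZ IN ITS OPERATOR DATUM within the margin `r X > 0` measured by `dist X`, with modulus
`Λ` and the decay factor `e^{−κd(X)}`.  Printed TYPE (small-field expansions): the terms are functionals of the operators, analytic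
and bounded for arbitrary operators with the same regularity and bounds ([Balaban1988RG2Cluster] p. 3, p. 5); a Cauchy estimate along
a complex operator line then gives this shape with `Λ = (sup bound)/(1 − reach)` — route P1's `dataLipschitz_of_fibreEnvelopes`.
CONTEXT only; asserted for nothing of Bałaban's. [bookkeeping] [cite: Balaban1988RG2Cluster, p.3] -/
def OpLip (Ψ : Op → GenMap C C.BgB) (W : Set (ℕ → ℝ)) (κ : ℝ)
    (Adm : (ℕ → ℝ) → BTable C C.BgB → ETable C C.BgB → Prop) (dist : C.Dom → Op → Op → ℝ) (r : C.Dom → ℝ)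
    (Λ : ℝ) : Prop :=
  ∀ g ∈ W, ∀ (f : BTable C C.BgB) (e : ETable C C.BgB), Adm g f e →
    ∀ (X : C.Dom) (q q' : Op), dist X q q' ≤ r X →
      ∀ (U : C.BgB), ∀ a ∈ C.admFl,
        |Ψ q g f e X U a - Ψ q' g f e X U a| ≤ Λ * (dist X q q' / r X) * Real.exp (-(κ * C.d X))

/-- **HYPOTHESIS SHAPE `OpRate`** (NOT PRINTED; rows NE2 ∧ NE3's objects): the two runs' operator data for the generation of the
piece `X` differ, in the step's own gauge `dist X` and in units of the margin `r X`, by at most `δ·θ^{scale X}` — the η-rate of the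
step's covariances, propagators, minimizers, averaging operators and internal backgrounds at spacings ε and ε/L.  Same currency as
route P1's wall W1 `StepModel.OperatorRate` (`δ·θ^k·rOp k`).  The manuscripts construct ONE run ((3.27) p. 271 is CONTEXT only);
asserted for nothing of Bałaban's. [bookkeeping] [cite: Balaban1988Convergent, (3.27) p.271] -/
def OpRate (opA opB : (ℕ → ℝ) → C.Dom → Op) (W : Set (ℕ → ℝ)) (dist : C.Dom → Op → Op → ℝ) (r : C.Dom → ℝ)
    (δ θ : ℝ) : Prop :=
  ∀ g ∈ W, ∀ X : C.Dom, dist X (opA g X) (opB g X) ≤ δ * θ ^ C.scale X * r X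

/-! ## §2 The split of `OpDisc` and the END face with the split in place -/

/-- **`OpDisc` FROM ITS THREE CONSTITUENTS** [folklore]: reading of both runs through one map `Ψ` + one-run operator modulus `Λ`
within the margin + operator η-rate `δ` in margin units (with `δ·θ^{scale X} ≤ 1`, so the two data are within the margin) + run A's
transported tables admissible ⟹ `OpDisc` with `Cop = Λ·δ` (no sign hypothesis on `δ`, `θ` is needed).  Proof: rewrite both
sides through `Ψ`, apply `OpLip` at `q = opA g X`, `q' = opB g X`, and bound `dist/r ≤ δ·θ^{scale X}`. -/
theorem opDisc_of_split {Ψ : Op → GenMap C C.BgB} {opA opB : (ℕ → ℝ) → C.Dom → Op} {ΦA : GenMap C C.BgA}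
    {Φ : GenMap C C.BgB} {BA : BFunctional C C.BgA} {EA : Functional C.toCarriers C.BgA} {W : Set (ℕ → ℝ)}
    {Adm : (ℕ → ℝ) → BTable C C.BgB → ETable C C.BgB → Prop} {dist : C.Dom → Op → Op → ℝ} {r : C.Dom → ℝ}
    {κ Λ δ θ : ℝ}
    (hRA : ReadsOpA Ψ opA ΦA BA EA W) (hRB : ReadsOpB Ψ opB Φ W Adm) (hL : OpLip Ψ W κ Adm dist r Λ)
    (hR : OpRate opA opB W dist r δ θ) (hadmA : ∀ g ∈ W, Adm g (pullB BA g) (epullB EA g))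
    (hr : ∀ X, 0 < r X) (hΛ : 0 ≤ Λ) (hreach : ∀ X : C.Dom, δ * θ ^ C.scale X ≤ 1) :
    OpDisc ΦA Φ BA EA W κ θ (Λ * δ) := by
  intro g hg X U a ha
  have hd := hR g hg X
  have hdr : dist X (opA g X) (opB g X) ≤ r X := by
    have h1 : δ * θ ^ C.scale X * r X ≤ 1 * r X := mul_le_mul_of_nonneg_right (hreach X) (hr X).le
    linarith
  have h := hL g hg (pullB BA g) (epullB EA g) (hadmA g hg) X (opA g X) (opB g X) hdr U a ha
  rw [hRA g hg X U a ha, hRB g hg (pullB BA g) (epullB EA g) (hadmA g hg) X U a ha]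
  have hq : dist X (opA g X) (opB g X) / r X ≤ δ * θ ^ C.scale X := by
    rw [div_le_iff₀ (hr X)]
    exact hd
  have hexp : 0 ≤ Real.exp (-(κ * C.d X)) := (Real.exp_pos _).le
  calc |Ψ (opA g X) g (pullB BA g) (epullB EA g) X U a - Ψ (opB g X) g (pullB BA g) (epullB EA g) X U a|
      ≤ Λ * (dist X (opA g X) (opB g X) / r X) * Real.exp (-(κ * C.d X)) := h
    _ ≤ Λ * (δ * θ ^ C.scale X) * Real.exp (-(κ * C.d X)) :=
        mul_le_mul_of_nonneg_right (mul_le_mul_of_nonneg_left hq hΛ) hexp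
    _ = Λ * δ * θ ^ C.scale X * Real.exp (-(κ * C.d X)) := by ring

/-- **END FACE WITH THE SPLIT IN PLACE** [folklore]: the parent's `ne5B_of_split` with its binder `hOD : OpDisc …` PRODUCED by
`opDisc_of_split` — conclusion `T4BoundaryCarrier.NE5B` literally (= `T4OutputRate.NE5` at every admissible pending field), constant
`(Λ·δ + lamE·CE)/(1 − k₀·Mc·(ωV/θ)/(1 − ωV/θ))`.  After this face the two-run binders of the boundary-member frame are exactly:
`OpRate` (rows NE2 ∧ NE3), the admissibility `hadmA` of run A's transported tables, and the sibling members' rate `hE`; everything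
else is one-run or bookkeeping. -/
theorem ne5B_of_opSplit {G : Generation C} {Ψ : Op → GenMap C C.BgB} {opA opB : (ℕ → ℝ) → C.Dom → Op}
    {ΦA : GenMap C C.BgA} {Φ : GenMap C C.BgB} {BA : BFunctional C C.BgA} {BB : BFunctional C C.BgB}
    {EA : Functional C.toCarriers C.BgA} {EB : Functional C.toCarriers C.BgB} {W : Set (ℕ → ℝ)}
    {Adm : (ℕ → ℝ) → BTable C C.BgB → ETable C C.BgB → Prop} {dist : C.Dom → Op → Op → ℝ} {r : C.Dom → ℝ}
    {κ θ ω k₀ Mc V Λ δ CE lamE : ℝ} {w : C.Dom → C.Dom → ℝ}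
    (hRepA : RepresentsA ΦA BA EA W) (hRepB : RepresentsB Φ BB EB W) (hIL : InputLipB G Φ W κ Adm)
    (hRA : ReadsOpA Ψ opA ΦA BA EA W) (hRB : ReadsOpB Ψ opB Φ W Adm) (hL : OpLip Ψ W κ Adm dist r Λ)
    (hR : OpRate opA opB W dist r δ θ) (hr : ∀ X, 0 < r X) (hreach : ∀ X : C.Dom, δ * θ ^ C.scale X ≤ 1)
    (hadmA : ∀ g ∈ W, Adm g (pullB BA g) (epullB EA g)) (hadmB : ∀ g ∈ W, Adm g (tabB BB g) (etabB EB g))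
    (hP : PerParentDamped G ω k₀ w) (hS : SliceCountGrowing G κ w Mc V)
    (hKE : EKernelContracts G κ θ lamE) (hE : NE5 EA EB W κ θ CE)
    (hθ : 0 < θ) (hω : 0 ≤ ω) (hV : 0 ≤ V) (hωθ : ω * V < θ) (hk₀ : 0 ≤ k₀) (hMc : 0 ≤ Mc)
    (hsmall : k₀ * Mc * (ω * V / θ) / (1 - ω * V / θ) < 1) (hΛ : 0 ≤ Λ) (hδ : 0 ≤ δ) (hCE : 0 ≤ CE)
    (hlamE : 0 ≤ lamE) :
    NE5B BA BB W κ θ ((Λ * δ + lamE * CE) / (1 - k₀ * Mc * (ω * V / θ) / (1 - ω * V / θ))) :=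
  ne5B_of_split hRepA hRepB hIL (opDisc_of_split hRA hRB hL hR hadmA hr hΛ hreach) hadmA hadmB hP hS hKE hE
    hθ hω hV hωθ hk₀ hMc hsmall (mul_nonneg hΛ hδ) hCE hlamE

/-! ## §3 Non-degeneracy: the split realised on the parent's chain instance with `Λ = δ = 1` -/

/-- The chain's common generation map with a real OPERATOR SOURCE `q`: the input part of `T4BoundaryRate.chainGenB θ` plus `q`.
[folklore] -/
def chainPsi (θ : ℝ) (q : ℝ) : GenMap chainCarriers chainCarriers.BgB := fun _ f _ (n : ℕ) U a =>
  (match n with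
    | 0 => 0
    | m + 1 => θ * f m U a) + q

/-- Run A's chain operator datum: the source `θ^{n}` for the piece `n`. [folklore] -/
def chainOpA (θ : ℝ) : (ℕ → ℝ) → ℕ → ℝ := fun _ n => θ ^ n

/-- Run B's chain operator datum: no source. [folklore] -/
def chainOpB : (ℕ → ℝ) → ℕ → ℝ := fun _ _ => 0

/-- On the chain, `chainGenA θ` is read through `chainPsi θ` at the datum `θ^{n}` (the transport is the identity). [folklore] -/
theorem chain_readsOpA (θ : ℝ) (W : Set (ℕ → ℝ)) :
    ReadsOpA (chainPsi θ) (chainOpA θ) (chainGenA θ) (chainBA θ) chainEA W := by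
  intro g _ n U a _
  cases n with
  | zero => simp [chainGenA, chainPsi, chainOpA]
  | succ m => simp [chainGenA, chainPsi, chainOpA, tabA, pullB]

/-- On the chain, `chainGenB θ` is read through `chainPsi θ` at the datum `0` (every table admissible). [folklore] -/
theorem chain_readsOpB (θ : ℝ) (W : Set (ℕ → ℝ)) :
    ReadsOpB (chainPsi θ) chainOpB (chainGenB θ) W (fun _ _ _ => True) := by
  intro g _ f e _ n U a _
  cases n with
  | zero => simp [chainGenB, chainPsi, chainOpB]
  | succ m => simp [chainGenB, chainPsi, chainOpB]

/-- On the chain, `chainPsi θ` is operator-Lipschitz with modulus `Λ = 1`, margin `1`, gauge `|q − q'|` (κ = 0). [folklore] -/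
theorem chain_opLip (θ : ℝ) (W : Set (ℕ → ℝ)) :
    OpLip (chainPsi θ) W 0 (fun _ _ _ => True) (fun _ q q' => |q - q'|) (fun _ => 1) 1 := by
  intro g _ f e _ n q q' _ U a _
  have h : chainPsi θ q g f e n U a - chainPsi θ q' g f e n U a = q - q' := by
    simp only [chainPsi]
    ring
  rw [h]
  simp

/-- On the chain, the operator data differ by EXACTLY the rate profile: `OpRate` with `δ = 1`. [folklore] -/
theorem chain_opRate {θ : ℝ} (hθ : 0 ≤ θ) (W : Set (ℕ → ℝ)) :
    OpRate (C := chainCarriers) (chainOpA θ) chainOpB W (fun _ q q' => |q - q'|) (fun _ => 1) 1 θ := by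
  intro g _ n
  simp [chainOpA, chainOpB, abs_of_nonneg (pow_nonneg hθ n)]

/-- CONSISTENCY WITH THE PARENT [folklore]: for `0 ≤ θ ≤ 1` the split recovers `T4BoundaryRate.chain_opDisc` — `OpDisc` on the chain
with `Cop = Λ·δ = 1·1` — from the three constituents, so the split is realisable with the operator source carrying exactly the rate
and none of the three constituents degenerate. -/
theorem chain_opDisc_of_split {θ : ℝ} (hθ : 0 ≤ θ) (hθ1 : θ ≤ 1) (W : Set (ℕ → ℝ)) :
    OpDisc (chainGenA θ) (chainGenB θ) (chainBA θ) chainEA W 0 θ (1 * 1) :=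
  opDisc_of_split (Adm := fun _ _ _ => True) (chain_readsOpA θ W) (chain_readsOpB θ W) (chain_opLip θ W)
    (chain_opRate hθ W) (fun _ _ => trivial) (fun _ => one_pos) zero_le_one
    (fun n => by simpa using pow_le_one₀ hθ hθ1)

end Summit.QuantumFields.BalabanUV.T4Continuum.BoundaryRateOpDisc
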